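import Mathlib
import HarnessLib
import Summits.HubbardSuperconductivity.HubbardSuperconductivity.Theorems.KLProgrammeKLRegimeEnginePairLadderTowerComposeV17F2

/-!
# Route `KLProgramme` — crux K3, ENGINE child gen 8 (stmt-HubbardSuperconductivity-20437 `KLRegimeEngineV17F2`), stub (c) `stub_engine_step_values`,
# (R47h) v2 class #5 as the COMPLEMENTARY FAMILY (p1 g11 E2-FAMILY-NOTE, (q6″)): the TWO-relation forward door — `kltc_two_compose_fwd_on`,
# `pairLadderStepAtV17F2_of_member_fwd`

Cell gate-hubbard-kl, seat hubbard-kl-k3c1-p1 (g9), technique «composed-map remainder propagation».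

Under the family organisation of class #5 (`A_n[D] := 𝒱₄(e^{Δ_D}𝒱_n)`, members `D = D_n − D_m`, `m ≥ n`; p1 g11 E2-FAMILY-NOTE §2, identity p540985) the slot step
(E2-F2)ₙ is a composition of exactly TWO resolvent relations — the HISTORY member `m = n` at scale `n−1` in forward form, `X ≈ F_{−b′}(C₀)`
(`C₀ = klPairArrayF (n−1)`, `X` = the bare-ball array of `A_{n−1}[g_n]`), and the member's Wick tower along slice `n`, `Y ≈ F_{w₁}(X)` with `Y = klPairArrayF n`
(the member `D_n − D_n = 0` IS the plain array) — giving `Y ≈ F_{w₁ − b′}(C₀)`: no second straddle, no un-smearing.  (The re-export of every other member at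
scale `n` is `kltc_transfer_compose_fwd_on`, p540411, once per `m`.)

* §1 `kltc_two_compose_fwd_on` — any finite carrier, any truncation set `B`: the two-relation composition with the weighted four-term defect
  `E_a + FT_{|w₁|}(R′)` (constants `3m/2`, `3m/2 + r′`), two-sided inverse for the weight `w₁ − b′`; smallness `m·Σ|b′| ≤ 1/3`, `((3/2)m + r′)·Σ|w₁| ≤ 1/3`.
  It is `kltc_compose_fwd_on` (p526646) with the trivial third relation (`b = 0`, `M₀ = 1`, `E_R = 0`).
* §2 `pairLadderStepAtV17F2_of_member_fwd` — BY NAME on `…SplitSlotsV17F2`: per pair class the caller supplies the member array `X` (any matrix vanishing off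
  the bare ball), real weights `b′` (history member) and `w₁` (tower), the two relations with error majorants on the ball, the intermediate majorant `E₁`,
  smallness, the two mass lines of the composite `w₁ − b′` and ONE closed-form budget inequality `E₁ ≤` the (E2-F2) line ⟹ `PairLadderStepAtV17F2 … n` (`1 ≤ n`).

Exact algebra over landed lemmas; nothing about the model's sizes is asserted.  0 kit.
-/

noncomputable section

namespace Summit.HubbardSuperconductivity.HubbardSuperconductivity.Theorems.KLRegimeSplit

set_option linter.dupNamespace false -- summit = problem name (single-conjunct summit), D-0017

open Finset Matrix Literature.MathematicalPhysics.QuantumLattice Literature.Probability.LatticeModels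
open Summit.HubbardSuperconductivity.HubbardSuperconductivity.Theorems.KLProgrammeLegKernels

/-! ## §1 The two-relation forward composition on an arbitrary truncation set -/

section Compose

variable {S : Type*} [Fintype S] [DecidableEq S] [Nonempty S]

/-- **Two-relation forward composition.**  Arrays `C₀` (`|C₀| ≤ m`), `X`, `Y` vanishing off `B²`; real weights `b′`, `w₁`; right inverses `M′` of
`1 − diag b′·C₀` and `N` of `1 + diag w₁·X`; error majorants on `B²`: `‖X − C₀M′‖ ≤ R′ ≤ r′`, `‖Y − XN‖ ≤ E_a`; an intermediate majorant
`E₁ ≥ E_a + FT_{|w₁|}(R′)` (`FT` with the constants `3m/2`, `3m/2 + r′`), `E₁ ≤ e₁`; smallness `m·Σ|b′| ≤ 1/3`, `((3/2)m + r′)·Σ|w₁| ≤ 1/3`.  THEN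
`1 + diag(w₁ − b′)·C₀` has a two-sided inverse `N₂` with `‖Y − C₀N₂‖ ≤ E₁` on `B²`. -/
theorem kltc_two_compose_fwd_on (B : Finset S) (C₀ X Y M' N : Matrix S S ℂ) (b' w₁ : S → ℝ) (R' Ea E₁ : S → S → ℝ)
    {m r' e₁ : ℝ} (hm : 0 ≤ m) (hr' : 0 ≤ r') (he₁ : 0 ≤ e₁) (hC₀ : ∀ s t, ‖C₀ s t‖ ≤ m)
    (hC₀0 : ∀ x y, ¬(x ∈ B ∧ y ∈ B) → C₀ x y = 0) (hX0 : ∀ x y, ¬(x ∈ B ∧ y ∈ B) → X x y = 0)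
    (hY0 : ∀ x y, ¬(x ∈ B ∧ y ∈ B) → Y x y = 0) (hR'0 : ∀ x y, 0 ≤ R' x y) (hEa0 : ∀ x y, 0 ≤ Ea x y)
    (hM' : (1 - diagonal (fun p => (b' p : ℂ)) * C₀) * M' = 1)
    (hR' : ∀ k ∈ B, ∀ k' ∈ B, ‖X k k' - (C₀ * M') k k'‖ ≤ R' k k') (hR'e : ∀ x y, R' x y ≤ r')
    (hN : (1 + diagonal (fun p => (w₁ p : ℂ)) * X) * N = 1)
    (hEa : ∀ k ∈ B, ∀ k' ∈ B, ‖Y k k' - (X * N) k k'‖ ≤ Ea k k')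
    (hE₁ : ∀ x y, Ea x y + (R' x y + 3 / 2 * (3 / 2 * m) * ∑ t, R' x t * |w₁ t| + 3 / 2 * (3 / 2 * m + r') * ∑ a, |w₁ a| * R' a y +
        9 / 4 * (3 / 2 * m + r') * (3 / 2 * m) * ∑ a, ∑ t, |w₁ a| * R' a t * |w₁ t|) ≤ E₁ x y)
    (hE₁e : ∀ x y, E₁ x y ≤ e₁)
    (hsm₀ : m * ∑ a, |b' a| ≤ 1 / 3) (hsm₁ : (3 / 2 * m + r') * ∑ a, |w₁ a| ≤ 1 / 3) :
    ∃ N₂ : Matrix S S ℂ,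
      (1 + diagonal (fun p => ((w₁ p - b' p : ℝ) : ℂ)) * C₀) * N₂ = 1 ∧
      N₂ * (1 + diagonal (fun p => ((w₁ p - b' p : ℝ) : ℂ)) * C₀) = 1 ∧
      ∀ k ∈ B, ∀ k' ∈ B, ‖Y k k' - (C₀ * N₂) k k'‖ ≤ E₁ k k' := by
  -- the trivial third relation: `Y ≈ F_{−0}(Y)` with right inverse `1` and error `0`
  have hM₀ : (1 - diagonal (fun _ : S => ((0 : ℝ) : ℂ)) * Y) * (1 : Matrix S S ℂ) = 1 := by
    have hd : diagonal (fun _ : S => ((0 : ℝ) : ℂ)) = 0 := by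
      rw [Complex.ofReal_zero]; exact diagonal_zero
    rw [hd, zero_mul, sub_zero, mul_one]
  have hER : ∀ k ∈ B, ∀ k' ∈ B, ‖Y k k' - (Y * (1 : Matrix S S ℂ)) k k'‖ ≤ (0 : ℝ) := by
    intro k _ k' _; rw [mul_one, sub_self, norm_zero]
  have hE₁0 : ∀ x y, 0 ≤ E₁ x y := by
    intro x y
    refine le_trans ?_ (hE₁ x y)
    have ha : ∀ a, 0 ≤ |w₁ a| := fun a => abs_nonneg _
    have h1 : 0 ≤ ∑ t, R' x t * |w₁ t| := sum_nonneg fun t _ => mul_nonneg (hR'0 x t) (ha t)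
    have h2 : 0 ≤ ∑ a, |w₁ a| * R' a y := sum_nonneg fun a _ => mul_nonneg (ha a) (hR'0 a y)
    have h3 : 0 ≤ ∑ a, ∑ t, |w₁ a| * R' a t * |w₁ t| :=
      sum_nonneg fun a _ => sum_nonneg fun t _ => mul_nonneg (mul_nonneg (ha a) (hR'0 a t)) (ha t)
    have := hEa0 x y; have := hR'0 x y
    positivity
  have hsm₂ : (9 / 4 * m + e₁ + 0) * ∑ a, |(fun _ : S => (0 : ℝ)) a| ≤ 1 / 3 := by
    simp only [abs_zero, sum_const_zero, mul_zero]; norm_num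
  obtain ⟨N₂, h1, h2, hbd⟩ := kltc_compose_fwd_on B C₀ Y X Y M' N 1 b' w₁ (fun _ => (0 : ℝ)) R' Ea (fun _ _ => (0 : ℝ)) E₁ E₁ hm hr'
    le_rfl he₁ hC₀ hC₀0 hY0 hX0 hY0 hR'0 hEa0 (fun _ _ => le_rfl) hM' hR' hR'e hN hEa hM₀ hER (fun _ _ => le_rfl) hE₁ hE₁e
    (fun x y => by rw [zero_add]) hsm₀ hsm₁ hsm₂
  have hfun : (fun p => ((w₁ p + (fun _ : S => (0 : ℝ)) p - b' p : ℝ) : ℂ)) = fun p => ((w₁ p - b' p : ℝ) : ℂ) := by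
    funext p; simp
  rw [hfun] at h1 h2
  refine ⟨N₂, h1, h2, fun k hk k' hk' => ?_⟩
  have h := hbd k hk k' hk'
  simp only [abs_zero, mul_zero, zero_mul, sum_const_zero, add_zero] at h
  exact h

end Compose

/-! ## §2 Model: (E2-F2) from the history member `m = n` and its tower, BY NAME -/

section Model

variable (L M : ℕ) [NeZero L] [NeZero M]

/-- **(E2-F2) `PairLadderStepAtV17F2 … n` (`1 ≤ n`) from the class-#5 FAMILY: the history member `A_{n−1}[g_n]` (forward straddle against
`klPairArrayF (n−1)`, weight `b′`, error `R′`) and its Wick tower along slice `n` ending at the PLAIN array `klPairArrayF n` (weight `w₁`, error `E_a`).**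
Per pair class the caller supplies: the member array `X` (any matrix vanishing off the bare ball), the two relations, majorants `R′ ≤ r′`, `E_a`, `E₁ ≥
E_a + FT_{|w₁|}(R′)` with `E₁ ≤ e₁`, smallness `m·Σ|b′| ≤ 1/3`, `((3/2)m + r′)·Σ|w₁| ≤ 1/3` (`m ≥ sup|klPairArrayF (n−1)|`), the two mass lines of the composite
weight `w₁ − b′`, and `E₁ ≤` the (E2-F2) budget line at the external entries. -/
theorem pairLadderStepAtV17F2_of_member_fwd {G : GeoConsts} {P : SplitConsts} {Q : EngConsts} {β U μ : ℝ} {n : ℕ} {m : ℝ} (hn : 1 ≤ n)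
    (hm : 0 ≤ m) (hC₀ : ∀ Qm s t, ‖klPairArrayF L M β U μ (n - 1) Qm s t‖ ≤ m)
    (hmember : ∀ Qm : TorusSite 2 L, IsPairClassAt L Qm n →
      ∃ (X M' N : Matrix (TorusSite 2 L) (TorusSite 2 L) ℂ) (b' w₁ : TorusSite 2 L → ℝ)
        (R' Ea E₁ : TorusSite 2 L → TorusSite 2 L → ℝ) (r' e₁ : ℝ),
        0 ≤ r' ∧ 0 ≤ e₁ ∧
        (∀ x y, ¬(x ∈ klBall L μ 0 ∧ y ∈ klBall L μ 0) → X x y = 0) ∧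
        (∀ x y, 0 ≤ R' x y) ∧ (∀ x y, 0 ≤ Ea x y) ∧
        (1 - diagonal (fun p => (b' p : ℂ)) * klPairArrayF L M β U μ (n - 1) Qm) * M' = 1 ∧
        (∀ k ∈ klBall L μ 0, ∀ k' ∈ klBall L μ 0, ‖X k k' - (klPairArrayF L M β U μ (n - 1) Qm * M') k k'‖ ≤ R' k k') ∧
        (∀ x y, R' x y ≤ r') ∧
        (1 + diagonal (fun p => (w₁ p : ℂ)) * X) * N = 1 ∧
        (∀ k ∈ klBall L μ 0, ∀ k' ∈ klBall L μ 0, ‖klPairArrayF L M β U μ n Qm k k' - (X * N) k k'‖ ≤ Ea k k') ∧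
        (∀ x y, Ea x y + (R' x y + 3 / 2 * (3 / 2 * m) * ∑ t, R' x t * |w₁ t| + 3 / 2 * (3 / 2 * m + r') * ∑ a, |w₁ a| * R' a y +
            9 / 4 * (3 / 2 * m + r') * (3 / 2 * m) * ∑ a, ∑ t, |w₁ a| * R' a t * |w₁ t|) ≤ E₁ x y) ∧
        (∀ x y, E₁ x y ≤ e₁) ∧
        m * ∑ a, |b' a| ≤ 1 / 3 ∧ (3 / 2 * m + r') * ∑ a, |w₁ a| ≤ 1 / 3 ∧
        (∑ p, |w₁ p - b' p| ≤ G.bhi) ∧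
        (∑ p, (|w₁ p - b' p| - (w₁ p - b' p)) ≤ 2 * klEdge G n (klTorusNorm L Qm)) ∧
        (∀ k ∈ klBall L μ 0, ∀ k' ∈ klBall L μ 0,
          E₁ k k' ≤
            drivePBar G P U (n - 1) + eremBar G P Q U β L (n - 1) + thermalBar G P U β n +
              legDressBarQ2 G P Q U n (legSliceCountT L β μ (klFlowFrameU L M β U μ n) n ![k', Qm - k', Qm - k, k]) +
              (P.Klam * U) ^ 2 * (G.phGain n (klTorusNorm L (k - k')) + G.phGain n (klTorusNorm L (k + k' - Qm))) +
              frameShiftBar P Q U n)) :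
    PairLadderStepAtV17F2 L M G P Q β U μ n := by
  refine ⟨fun h0 => absurd h0 (by omega), fun _ Qm hQm => ?_⟩
  obtain ⟨X, M', N, b', w₁, R', Ea, E₁, r', e₁, hr', he₁, hX0, hR'0, hEa0, hM', hR', hR'e, hN, hEa, hE₁, hE₁e, hsm₀, hsm₁, hmass, hneg,
    hbud⟩ := hmember Qm hQm
  obtain ⟨N₂, hN₂1, -, hbd⟩ := kltc_two_compose_fwd_on (klBall L μ 0) (klPairArrayF L M β U μ (n - 1) Qm) X (klPairArrayF L M β U μ n Qm) M' N
    b' w₁ R' Ea E₁ hm hr' he₁ (hC₀ Qm) (klPairArrayF_eq_zero_off L M β U μ (n - 1) Qm) hX0 (klPairArrayF_eq_zero_off L M β U μ n Qm) hR'0 hEa0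
    hM' hR' hR'e hN hEa hE₁ hE₁e hsm₀ hsm₁
  refine ⟨fun p => w₁ p - b' p, hmass, hneg, N₂, hN₂1, fun k hk k' hk' => ?_⟩
  have h := hbd k hk k' hk'
  rw [klPairArrayF_apply_of_mem L M β U μ n Qm hk hk'] at h
  exact h.trans (hbud k hk k' hk')

end Model

end Summit.HubbardSuperconductivity.HubbardSuperconductivity.Theorems.KLRegimeSplit

end
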